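import Mathlib.MeasureTheory.Integral.Bochner.Basic
import Mathlib.Analysis.SpecialFunctions.Integrals.Basic
import Literature.MathematicalPhysics.QuantumLattice.GrassmannKernelsPresented
import Literature.MathematicalPhysics.QuantumLattice.HubbardScaleReport

/-!
# Supports wave (lead c4) for crux `SeededBrokenRegimeBoseFermiPinned` (stmt-HubbardSuperconductivity-14047)

Restatement-invariant analysis layer: the kernel calculus of `∂_X`, `Δ_C` and products, and the
Gawȩdzki–Kupiainen / Salmhofer `L¹–L^∞` estimates for the two terms of Polchinski's equation
(`Δ_{Ċ} 𝒢` and `½ Σ Ċ ∂𝒢 ∂𝒢`) in the leg-weighted norm `legKernelNorm` the route's scale report uses;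
plus the Goldstone slab integral (P3a of `PostRestatementLine.md`).  Signatures only (registered stubs).
-/

set_option linter.dupNamespace false

namespace Summit.HubbardSuperconductivity.HubbardSuperconductivity.Theorems.AposterioriCapRgSeededBrokenRegimeBoseFermiPinned

open Literature.MathematicalPhysics.QuantumLattice GrassmannAlgebra MeasureTheory

/-- W1: the kernels of a left derivative. -/
theorem stub_kernelGrassmannDeriv :
    ∀ {R : Type} [CommRing R] [Algebra ℚ R] {Γ : Type} (F : GrassmannAlgebra R Γ) (Y : Γ) (m : ℕ) (X : Fin m → Γ),
      kernel R (grassmannDeriv R Y F) m X = ((m + 1 : ℕ) : R) * kernel R F (m + 1) (Fin.cons Y X) := by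
  sorry

/-- W2: the kernels of the fermionic Laplacian. -/
theorem stub_kernelGrassmannLaplacian :
    ∀ {R : Type} [CommRing R] [Algebra ℚ R] {Γ : Type} [Fintype Γ] (C : Matrix Γ Γ R) (F : GrassmannAlgebra R Γ)
      (m : ℕ) (Z : Fin m → Γ),
      kernel R (grassmannLaplacian R C F) m Z =
        ((1 / 2 : ℚ) • (1 : R)) * (((m + 2) * (m + 1) : ℕ) : R) *
          ∑ X, ∑ Y, C X Y * kernel R F (m + 2) (Fin.cons Y (Fin.cons X Z)) := by
  sorry

/-- W3: the kernel expansion (reconstruction) theorem. -/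
theorem stub_eq_sum_presented_kernel :
    ∀ {R : Type} [CommRing R] [Algebra ℚ R] {Γ : Type} [Fintype Γ] [DecidableEq Γ] (F : GrassmannAlgebra R Γ),
      F = ∑ m ∈ Finset.range (Fintype.card Γ + 1), presented R (kernel R F m) := by
  sorry

/-- W4a: subadditivity of the leg-weighted norm. -/
theorem stub_legKernelNormAddLe :
    ∀ {Γ : Type} [Fintype Γ] [DecidableEq Γ] (wt : Γ → ℝ), (∀ X, 0 ≤ wt X) → ∀ {ε : ℝ}, 0 ≤ ε →
      ∀ (m : ℕ) (K K' : (Fin m → Γ) → ℂ),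
        legKernelNorm wt ε m (K + K') ≤ legKernelNorm wt ε m K + legKernelNorm wt ε m K' := by
  sorry

/-- W4b: absolute homogeneity of the leg-weighted norm. -/
theorem stub_legKernelNormSmul :
    ∀ {Γ : Type} [Fintype Γ] [DecidableEq Γ] (wt : Γ → ℝ) (ε : ℝ) (m : ℕ) (c : ℂ) (K : (Fin m → Γ) → ℂ),
      legKernelNorm wt ε m (c • K) = ‖c‖ * legKernelNorm wt ε m K := by
  sorry

/-- W8: the leg-weighted norm of the kernel of a presented polynomial is at most that of its presentation. -/
theorem stub_legKernelNormKernelPresentedLe :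
    ∀ {Γ : Type} [Fintype Γ] [DecidableEq Γ] (wt : Γ → ℝ), (∀ X, 0 ≤ wt X) → ∀ {ε : ℝ}, 0 ≤ ε →
      ∀ (m : ℕ) (φ : (Fin m → Γ) → ℂ),
        legKernelNorm wt ε m (kernel ℂ (presented ℂ φ) m) ≤ legKernelNorm wt ε m φ := by
  sorry

/-- W7: the pinned `L¹–L^∞` estimate for a tensor product of two kernels contracted through one covariance line. -/
theorem stub_pinnedSumContractedTensorLe :
    ∀ {Γ : Type} [Fintype Γ] [DecidableEq Γ] (wt : Γ → ℝ), (∀ X, 0 ≤ wt X) →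
      ∀ (a b : ℕ) (A : (Fin (a + 1) → Γ) → ℂ) (B : (Fin (b + 1) → Γ) → ℂ) (C : Matrix Γ Γ ℂ) (D : Γ → Γ → ℝ),
        (∀ X Y, 0 ≤ D X Y) → (∀ X Y, ‖C X Y‖ ≤ wt X * wt Y * D X Y) →
        ∀ (cA cB cR cC : ℝ),
          (∀ (p : Fin (a + 1)) (x : Γ),
            ∑ U ∈ Finset.univ.filter (fun U : Fin (a + 1) → Γ => U p = x), (∏ q, wt (U q)) * ‖A U‖ ≤ cA) →
          (∀ (p : Fin (b + 1)) (x : Γ),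
            ∑ V ∈ Finset.univ.filter (fun V : Fin (b + 1) → Γ => V p = x), (∏ q, wt (V q)) * ‖B V‖ ≤ cB) →
          (∀ X, ∑ Y, D X Y ≤ cR) → (∀ Y, ∑ X, D X Y ≤ cC) →
          ∀ (p : Fin (a + b)) (w : Γ),
            ∑ W ∈ Finset.univ.filter (fun W : Fin (a + b) → Γ => W p = w),
                (∏ q, wt (W q)) *
                  ‖∑ X, ∑ Y, C X Y * (A (Fin.cons X fun i => W (Fin.castAdd b i)) *
                    B (Fin.cons Y fun j => W (Fin.natAdd a j)))‖ ≤ max cR cC * (cA * cB) := by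
  sorry

/-- W6 (P3a): the Goldstone exchange is integrable on the below-scale slab in `2+1` dimensions, uniformly in the
transverse mass `a ≥ 0`, with the natural `Λ₀` scaling. -/
theorem stub_goldstoneSlabIntegrable :
    ∀ (Kτ Kx c : ℝ), 0 < Kτ → 0 < Kx → 0 < c → ∃ C : ℝ, ∀ Λ₀ : ℝ, 0 < Λ₀ → ∀ a : ℝ, 0 ≤ a →
      ∫ ν in Set.Icc (-(2 * Λ₀)) (2 * Λ₀), ∫ q in Set.Icc (-(c * Λ₀)) (c * Λ₀), ∫ p : ℝ,
          (Kτ * ν ^ 2 + Kx * (q ^ 2 + p ^ 2) + a)⁻¹ ≤ C * Λ₀ := by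
  sorry

/-- V1 (wave 2): the `L¹–L^∞` estimate for the Laplacian term of Polchinski's equation. -/
theorem stub_legKernelNormLaplacianLe :
    ∀ {Γ : Type} [Fintype Γ] [DecidableEq Γ] (wt : Γ → ℝ), (∀ X, 0 ≤ wt X) → ∀ {ε : ℝ}, 0 < ε →
      ∀ (C : Matrix Γ Γ ℂ) (c : ℝ), (∀ X Y, ‖C X Y‖ ≤ c * (wt X * wt Y)) → ∀ (F : GrassmannAlgebra ℂ Γ) (m : ℕ),
        legKernelNorm wt ε (m + 1) (weightedKernel ε (grassmannLaplacian ℂ C F) (m + 1)) ≤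
          ((m + 3) * (m + 2) / 2 : ℝ) * c * legKernelNorm wt ε (m + 3) (weightedKernel ε F (m + 3)) := by
  sorry

/-- V2 (wave 2): the `L¹–L^∞` estimate for the bilinear term of Polchinski's equation. -/
theorem stub_legKernelNormPolchinskiBilinearLe :
    ∀ {Γ : Type} [Fintype Γ] [DecidableEq Γ] (wt : Γ → ℝ), (∀ X, 0 ≤ wt X) → ∀ {ε : ℝ}, 0 < ε →
      ∀ (C : Matrix Γ Γ ℂ) (D : Γ → Γ → ℝ), (∀ X Y, 0 ≤ D X Y) → (∀ X Y, ‖C X Y‖ ≤ wt X * wt Y * D X Y) →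
        ∀ (cD : ℝ), (∀ X, ε * ∑ Y, D X Y ≤ cD) → (∀ Y, ε * ∑ X, D X Y ≤ cD) →
        ∀ (F G : GrassmannAlgebra ℂ Γ) (n : ℕ),
          legKernelNorm wt ε (n + 1)
              (weightedKernel ε (∑ X, ∑ Y, C X Y • (grassmannDeriv ℂ X F * grassmannDeriv ℂ Y G)) (n + 1)) ≤
            cD * ∑ a ∈ Finset.range (n + 2), ∑ b ∈ Finset.range (n + 2),
              (if a + b = n + 1 then
                ((a + 1) * (b + 1) : ℝ) *
                  (legKernelNorm wt ε (a + 1) (weightedKernel ε F (a + 1)) *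
                    legKernelNorm wt ε (b + 1) (weightedKernel ε G (b + 1)))
              else 0) := by
  sorry

end Summit.HubbardSuperconductivity.HubbardSuperconductivity.Theorems.AposterioriCapRgSeededBrokenRegimeBoseFermiPinned
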